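import Mathlib.Algebra.Group.Units.Equiv
import Literature.InformationTheory.QuantumCodes.TwoBlockWheelComponents
import HarnessLib

/-!
# Vertex degrees of two-block / bivariate-bicycle Tanner graphs: "degree-6 Tanner graph",
# "each planar layer is a degree-3 graph"

Bravyi–Cross–Gambetta–Maslov–Rall–Yoder [BravyiEtAl2024]: "The Tanner graph of any BB code has vertex
degree six" (§3); "By construction, the code `QC(A,B)` has weight-6 check operators and each qubit
participates in six checks (three `X`-type plus three `Z`-type checks). Accordingly, the code `QC(A,B)`
has a degree-6 Tanner graph" (§4); and in the proof of Lemma 2: "`G_A` and `G_B` are regular degree-3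
graphs (since `Aᵢ` and `Bⱼ` are permutation matrices)".

PROVED here for every abelian two-block code `AbelianTwoBlock.css a b` (any finite abelian `G`):

* `degree_vX`, `degree_vZ`, `degree_vL`, `degree_vR`: EVERY vertex of the Tanner graph has degree
  `|supp a| + |supp b|` (`= hammingNorm a + hammingNorm b`): a check row of `[A|B]` has `|supp a|`
  entries in the left block and `|supp b|` in the right block, a qubit column likewise (translation
  invariance of circulant supports);
* `BB.hammingNorm_coeffVec_of_isBBPoly`: the printed weight-(3,3) side condition gives
  `|supp| = 3`, hence **`BB.Code.tannerGraph_degree_eq_six`**: every vertex of the Tanner graph of a BB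
  code `QC(A,B)` with `IsBBPoly A`, `IsBBPoly B` has degree `6`;
* `degree_eq_three_of_pair21` / `_of_pair12`: the Lemma-2 layers (a (2,1)- or (1,2)-pair, see
  `TwoBlockWheelGraphs.lean`) are 3-regular.

Degrees are Mathlib's `SimpleGraph.degree` (statements take the local-finiteness instance
`[Fintype (neighborSet v)]` as `SimpleGraph.degree` itself does; no instance is declared here).

## References (locators read on the page)
* [BravyiEtAl2024] Nature 627 (2024) 778 = arXiv:2308.07915: §3 (chunk p0007 L18), §4 (chunk p0009
  L53–56), proof of Lemma 2 (chunk p0010 L62).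
-/

namespace Literature.InformationTheory.QuantumCodes

open SimpleGraph

/-- The Hamming weight of a function on `α ⊕ β` is the sum of the weights of its two halves. [folklore] -/
private theorem hammingNorm_sum_elim {α β R : Type*} [Fintype α] [Fintype β] [Zero R] [DecidableEq R]
    (f : α → R) (g : β → R) : hammingNorm (Sum.elim f g) = hammingNorm f + hammingNorm g := by
  simp only [hammingNorm, Finset.card_filter, Fintype.sum_sum_type, Sum.elim_inl, Sum.elim_inr]
  congr 1

namespace AbelianTwoBlock

variable {G : Type*} [Fintype G] [AddCommGroup G]

/-- A translated support has the same size: `|{j : a(i − j) ≠ 0}| = |supp a|`. [folklore] -/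
private theorem hammingNorm_sub_left (a : G → ZMod 2) (i : G) :
    hammingNorm (fun j => a (i - j)) = hammingNorm a :=
  BB.hammingNorm_comp_equiv a (Equiv.subLeft i)

/-- `|{i : a(i − j) ≠ 0}| = |supp a|`. [folklore] -/
private theorem hammingNorm_sub_right (a : G → ZMod 2) (j : G) :
    hammingNorm (fun i => a (i - j)) = hammingNorm a :=
  BB.hammingNorm_comp_equiv a (Equiv.subRight j)

/-- **Degree of an `X`-check** = `|supp a| + |supp b|` (the weight of the check `[A|B]_i`).
[cite: BravyiEtAl2024, §4 "the code QC(A,B) has weight-6 check operators … a degree-6 Tanner graph" (arXiv:2308.07915 chunk p0009 L53–56)] -/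
theorem degree_vX (a b : G → ZMod 2) (i : G) [Fintype ((css a b).tannerGraph.neighborSet (vX i))] :
    (css a b).tannerGraph.degree (vX i) = hammingNorm a + hammingNorm b := by
  rw [CSSCode.tannerGraph_degree_xCheck]
  have : (css a b).HX i = Sum.elim (fun j => a (i - j)) (fun j => b (i - j)) := by
    ext (j | j) <;> simp
  rw [this, hammingNorm_sum_elim, hammingNorm_sub_left, hammingNorm_sub_left]

/-- **Degree of a `Z`-check** = `|supp a| + |supp b|` (the weight of the check `[Bᵀ|Aᵀ]_i`).
[cite: BravyiEtAl2024, §4 (arXiv:2308.07915 chunk p0009 L53–56)] -/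
theorem degree_vZ (a b : G → ZMod 2) (i : G) [Fintype ((css a b).tannerGraph.neighborSet (vZ i))] :
    (css a b).tannerGraph.degree (vZ i) = hammingNorm a + hammingNorm b := by
  rw [CSSCode.tannerGraph_degree_zCheck]
  have : (css a b).HZ i = Sum.elim (fun j => b (j - i)) (fun j => a (j - i)) := by
    ext (j | j) <;> simp
  rw [this, hammingNorm_sum_elim, hammingNorm_sub_right, hammingNorm_sub_right, add_comm]

/-- **Degree of a left qubit** = `|supp a| + |supp b|` ("each qubit participates in six checks (three
`X`-type plus three `Z`-type checks)"). [cite: BravyiEtAl2024, §4 (arXiv:2308.07915 chunk p0009 L53–56)] -/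
theorem degree_vL (a b : G → ZMod 2) (j : G) [Fintype ((css a b).tannerGraph.neighborSet (vL j))] :
    (css a b).tannerGraph.degree (vL j) = hammingNorm a + hammingNorm b := by
  rw [CSSCode.tannerGraph_degree_qubit]
  have h1 : (fun i => (css a b).HX i (Sum.inl j)) = fun i => a (i - j) := by ext i; simp
  have h2 : (fun i => (css a b).HZ i (Sum.inl j)) = fun i => b (j - i) := by ext i; simp
  rw [h1, h2, hammingNorm_sub_right, hammingNorm_sub_left]

/-- **Degree of a right qubit** = `|supp a| + |supp b|`. [cite: BravyiEtAl2024, §4 (arXiv:2308.07915 chunk p0009 L53–56)] -/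
theorem degree_vR (a b : G → ZMod 2) (j : G) [Fintype ((css a b).tannerGraph.neighborSet (vR j))] :
    (css a b).tannerGraph.degree (vR j) = hammingNorm a + hammingNorm b := by
  rw [CSSCode.tannerGraph_degree_qubit]
  have h1 : (fun i => (css a b).HX i (Sum.inr j)) = fun i => b (i - j) := by ext i; simp
  have h2 : (fun i => (css a b).HZ i (Sum.inr j)) = fun i => a (j - i) := by ext i; simp
  rw [h1, h2, hammingNorm_sub_right, hammingNorm_sub_left, add_comm]

/-- **Every vertex** of the Tanner graph of `css a b` has degree `|supp a| + |supp b|`.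
[cite: BravyiEtAl2024, §4 "Accordingly, the code QC(A,B) has a degree-6 Tanner graph" (arXiv:2308.07915 chunk p0009 L56)] -/
theorem degree_eq (a b : G → ZMod 2) (v : (G ⊕ G) ⊕ (G ⊕ G))
    [Fintype ((css a b).tannerGraph.neighborSet v)] :
    (css a b).tannerGraph.degree v = hammingNorm a + hammingNorm b := by
  rcases v with (i | i) | (j | j)
  · exact degree_vX a b i
  · exact degree_vZ a b i
  · exact degree_vL a b j
  · exact degree_vR a b j

/-- **The Lemma-2 layer `[A₂+A₃ | B₃]` is 3-regular**: for a (2,1)-pair (`supp a = {s, s'}`, `s ≠ s'`,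
`supp b = {t}`) every vertex has degree `3`.
[cite: BravyiEtAl2024, proof of Lemma 2 "G_A and G_B are regular degree-3 graphs (since Aᵢ and Bⱼ are permutation matrices)" (arXiv:2308.07915 chunk p0010 L62)] -/
theorem degree_eq_three_of_pair21 [DecidableEq G] {a b : G → ZMod 2} {s s' t : G}
    (ha : ∀ g, a g ≠ 0 ↔ g = s ∨ g = s')
    (hss : s ≠ s') (hb : ∀ g, b g ≠ 0 ↔ g = t) (v : (G ⊕ G) ⊕ (G ⊕ G))
    [Fintype ((css a b).tannerGraph.neighborSet v)] : (css a b).tannerGraph.degree v = 3 := by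
  rw [degree_eq]
  have h1 : hammingNorm a = 2 := by
    unfold hammingNorm
    rw [show (Finset.univ.filter fun g => a g ≠ 0) = {s, s'} from
      Finset.ext fun g => by simp [ha g]]
    exact Finset.card_pair hss
  have h2 : hammingNorm b = 1 := by
    unfold hammingNorm
    rw [show (Finset.univ.filter fun g => b g ≠ 0) = {t} from Finset.ext fun g => by simp [hb g]]
    exact Finset.card_singleton t
  rw [h1, h2]

/-- **The Lemma-2 layer `[A₁ | B₁+B₂]` is 3-regular** (a (1,2)-pair).
[cite: BravyiEtAl2024, proof of Lemma 2 "G_A and G_B are regular degree-3 graphs" (arXiv:2308.07915 chunk p0010 L62)] -/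
theorem degree_eq_three_of_pair12 [DecidableEq G] {a b : G → ZMod 2} {s t t' : G}
    (ha : ∀ g, a g ≠ 0 ↔ g = s)
    (htt : t ≠ t') (hb : ∀ g, b g ≠ 0 ↔ g = t ∨ g = t') (v : (G ⊕ G) ⊕ (G ⊕ G))
    [Fintype ((css a b).tannerGraph.neighborSet v)] : (css a b).tannerGraph.degree v = 3 := by
  rw [degree_eq]
  have h1 : hammingNorm a = 1 := by
    unfold hammingNorm
    rw [show (Finset.univ.filter fun g => a g ≠ 0) = {s} from Finset.ext fun g => by simp [ha g]]
    exact Finset.card_singleton s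
  have h2 : hammingNorm b = 2 := by
    unfold hammingNorm
    rw [show (Finset.univ.filter fun g => b g ≠ 0) = {t, t'} from
      Finset.ext fun g => by simp [hb g]]
    exact Finset.card_pair htt
  rw [h1, h2]

end AbelianTwoBlock

/-! ### Bivariate-bicycle phrasing: "The Tanner graph of any BB code has vertex degree six" -/

namespace BB

variable {ℓ m : ℕ} [NeZero ℓ] [NeZero m]

/-- A polynomial satisfying the printed weight-3 side condition has exactly three non-zero
coefficients, so does its coefficient vector. [cite: BravyiEtAl2024, §4 "A = A₁ + A₂ + A₃ … the Aᵢ are distinct" (arXiv:2308.07915 chunk p0009 L20–24)] -/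
theorem hammingNorm_coeffVec_of_isBBPoly {p : Poly ℓ m} (hp : IsBBPoly p) :
    hammingNorm (coeffVec p) = 3 := by
  obtain ⟨g₁, g₂, g₃, h₁₂, h₁₃, h₂₃, -, rfl⟩ := hp
  have hcoeff : coeffVec (monomial g₁.1 g₁.2 + monomial g₂.1 g₂.2 + monomial g₃.1 g₃.2) =
      (monomial g₁.1 g₁.2 + monomial g₂.1 g₂.2 + monomial g₃.1 g₃.2) ∘ (Equiv.neg (Mono ℓ m)) := by
    ext g; simp
  rw [hcoeff, hammingNorm_comp_equiv]
  unfold hammingNorm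
  rw [show (Finset.univ.filter fun g => (monomial g₁.1 g₁.2 + monomial g₂.1 g₂.2 +
      monomial g₃.1 g₃.2) g ≠ 0) = {g₁, g₂, g₃} from Finset.ext fun g => by
        rw [Finset.mem_filter, three_monomials_apply_ne_zero_iff g₁.1 g₁.2 g₂.1 g₂.2 g₃.1 g₃.2
          (by simpa using h₁₂) (by simpa using h₁₃) (by simpa using h₂₃)]
        simp]
  rw [Finset.card_insert_of_notMem (by simp [h₁₂, h₁₃]), Finset.card_pair h₂₃]

namespace Code

variable (C : Code ℓ m)

/-- **"The Tanner graph of any BB code has vertex degree six"**: if `A` and `B` satisfy the printed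
weight-3 side condition, every vertex (check or qubit) of the Tanner graph of `QC(A,B)` has degree 6.
[cite: BravyiEtAl2024, §3 "The Tanner graph of any BB code has vertex degree six" (arXiv:2308.07915 chunk p0007 L18); §4 (chunk p0009 L53–56)] -/
theorem tannerGraph_degree_eq_six (hA : IsBBPoly C.A) (hB : IsBBPoly C.B)
    (v : (Mono ℓ m ⊕ Mono ℓ m) ⊕ (Mono ℓ m ⊕ Mono ℓ m)) [Fintype (C.css.tannerGraph.neighborSet v)] :
    C.css.tannerGraph.degree v = 6 := by
  have h := @AbelianTwoBlock.degree_eq (Mono ℓ m) _ _ (coeffVec C.A) (coeffVec C.B) v ‹_›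
  rw [hammingNorm_coeffVec_of_isBBPoly hA, hammingNorm_coeffVec_of_isBBPoly hB] at h
  exact h

end Code

end BB

end Literature.InformationTheory.QuantumCodes
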